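import Summits.BirchSwinnertonDyer.BirchSwinnertonDyer.Theses.KatoDescentPotSupersingular
import Summits.BirchSwinnertonDyer.BirchSwinnertonDyer.Theorems.KatoDescentKMCImpReading
import Summits.BirchSwinnertonDyer.BirchSwinnertonDyer.Theorems.PotSupersingularWildLowerClassTransport
import Summits.BirchSwinnertonDyer.Rank1Residual.Additive.QuadraticTwistBSDComparisonIsogeny
import Summits.BirchSwinnertonDyer.Rank1Residual.O6.X3WildOfKMCTorsionFreeMember
import Summits.BirchSwinnertonDyer.Rank1Residual.Additive.N10IsogenyTransport
import Summits.BirchSwinnertonDyer.Rank1Residual.Additive.PotSupersingularClasses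
import Summits.BirchSwinnertonDyer.Rank1Residual.Additive.KatoDescentClosedBindersContraBridge
import HarnessLib

/-!
# Route K9 `KatoDescentPotSupersingular` — glue `WildLowerHalfRankZeroOfKMCFineContra` of the 19195 family (gen 3, print-exact KMC node), PROVED

Cell bsd-potss, plan g28 (CONVENTION Q re-key). The glue item `WildLowerHalfRankZeroOfKMCFineContra` of route `KatoDescentPotSupersingular` PROVED, type = the route
decl verbatim: the print-exact KMC node(s) at bsd-cm's contragredient closed pair
(`IsKatoZetaDescentDatumOfContra`, `KatoMainConjectureFineContra`, p628155) → HELD print readings → published facts →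
parent. Kernel: the generic `…_of_kmcImp…` descents of `KatoDescentKMCImpReading` with the interface lemma
`conj1210_of_isKatoZetaDescentDatumOfContra_of_katoMainConjectureFineContra` (in the `hread` binder shape: bsd-cm's landed
`ContraBridge.conj1210_of_isOfContra_of_kmcFineContra`, p629405); a torsion-free member by Mazur–Kenku
(`Addv.exists_torsionFree_member`); Cassels/GZK/modularity transport back to the row. Conditional content: none
beyond the displayed route items (two conjecture-grade nodes + held print inputs); nothing is credited toward BSD.
[cite: Kato2004Asterisque, Conj. 12.10 (p. 224), §14.14 (p. 243), Prop. 14.16 (p. 244)]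
[cite: BurnsKuriharaSano2019, Thm. 7.6 (p. 29)] [cite: Cassels1965ArithmeticVIII] [cite: Mazur1978, Thm. 1]
-/

set_option linter.dupNamespace false

noncomputable section

open scoped Classical

namespace Summit.BirchSwinnertonDyer.BirchSwinnertonDyer.Theorems

open WeierstrassCurve Literature.NumberTheory.EllipticCurves
  Literature.NumberTheory.EllipticCurves.Rank1Residual
  Literature.NumberTheory.EllipticCurves.Rank1Residual.Typed
  Summit.BirchSwinnertonDyer.Rank1Residual.Additive
  Summit.BirchSwinnertonDyer.Rank1Residual
  Summit.BirchSwinnertonDyer.BirchSwinnertonDyer.Theses.KatoDescentPotSupersingular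



/-- The intrinsic lower-half node `WildLowerIntrinsicNonCM` from the print-exact KMC node at the Contra pair, the held print
readings, the published facts and Mazur–Kenku: pass to a `3`-torsion-free class member (`Addv.exists_torsionFree_member`), run the
generic descent `KatoDescentKMCImpReading.missingPPartAt_rankZero_of_kmcImp` there, and transport the lower half back along the isogeny
(Cassels). [cite: Kato2004Asterisque, Conj. 12.10 (p. 224), Prop. 14.16 (p. 244)] [cite: Cassels1965ArithmeticVIII] [cite: Mazur1978, Thm. 1] -/
theorem wildLowerIntrinsicNonCM_of_kmcFineContra (hK : WildKMCFineContraIntrinsicNonCM)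
    (hPR : PrintInputKatoDescentReadingsContraW) (hF : PublishedFactsWildLowerW) (hMK : PublishedInputMazurKenkuW) :
    WildLowerIntrinsicNonCM := by
  obtain ⟨hC, hG, hM, -⟩ := hF
  intro W _ _ _ hr hO hnCM hintr
  obtain ⟨W', hW', hM', hiso, hadd', hj', ht'⟩ :=
    Addv.exists_torsionFree_member hMK hO.1 hO.2.1 hO.padicValRat_j_nonneg
  haveI := hW'
  haveI := hM'
  have hr' : W'.analyticRank = 0 := by rw [← analyticRank_eq_of_isIsogenous' hiso, hr]
  have hnCM' : ¬ W'.HasCM := fun h ↦ hnCM (X12.hasCM_of_isIsogenous hiso.symm_of_charZero h)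
  have hcls : ∃ (W₀ : WeierstrassCurve ℚ) (_ : W₀.IsElliptic) (_ : W₀.IsGloballyMinimal),
      ClassO6 W₀ 3 ∧ IsIsogenous W₀ W' := ⟨W, inferInstance, inferInstance, hO, hiso⟩
  have hintr' : ∀ (W'' : WeierstrassCurve ℚ) [W''.IsElliptic] [W''.IsGloballyMinimal], IsIsogenous W' W'' →
      ∀ q' : ℚ, shaAn W'' = (q' : ℂ) → 0 < padicValRat 3 q' :=
    fun W'' _ _ h'' q' hq ↦ hintr W'' (hiso.trans' h'') q' hq
  have hPP : MissingPPartAt W' 3 :=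
    KatoDescentKMCImpReading.missingPPartAt_rankZero_of_kmcImp W' 3 hPR.1 hPR.2 ContraBridge.conj1210_of_isOfContra_of_kmcFineContra hG hM hr'
      (by decide) hadd' hj' ht' (hK W' hr' hadd' hj' ht' hnCM' hcls hintr')
  exact TwistComparison.missingLowerBoundAt_of_isIsogenous W' W 3 hC hG hM hiso.symm_of_charZero
    (by rw [hr']; exact zero_le_one) (lower_and_upper_of_missingPPartAt W' 3 hPP).1

/-- **The gen-3 glue item CLOSED**: `WildLowerHalfRankZeroOfKMCFineContra` (children ⟹ `WildLowerHalfRankZero`). -/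
theorem wildLowerHalfRankZero_of_kmcFineContra :
    Summit.BirchSwinnertonDyer.BirchSwinnertonDyer.Theses.KatoDescentPotSupersingular.WildLowerHalfRankZeroOfKMCFineContra := by
  intro hK hPR hF hMK
  have hI := wildLowerIntrinsicNonCM_of_kmcFineContra hK hPR hF hMK
  obtain ⟨hC, hG, hM, hCM⟩ := hF
  intro W _ _ _ hr hO
  exact wild_lowerHalf_of_intrinsicNonCMRows hC hG hM hCM hI W hr hO


end Summit.BirchSwinnertonDyer.BirchSwinnertonDyer.Theorems

end
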